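import Literature.Computability.Complexity.NPClosureProofs
import Literature.Computability.Complexity.OracleProofs
import Literature.Computability.Complexity.StringSwap
import Literature.Computability.Complexity.StringCopy
import Literature.Computability.Complexity.CoinTruncation
import Literature.Computability.Complexity.PairProjections
import Mathlib.Tactic.DeriveFintype
import HarnessLib

/-!
# `P^{Σₖᵖ} ⊆ Σₖ₊₂ᵖ ∩ Πₖ₊₂ᵖ`: the `Δ`-levels of `PH` lie inside `PH` (proof; trunk CplxCore)

Stockmeyer (1976, §3, inclusion diagram and Thm. 3.1) places `Δₖ₊₁ᵖ = P^{Σₖᵖ}` inside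
`Σₖ₊₁ᵖ ∩ Πₖ₊₁ᵖ` ("since obviously `B ∈ P(B)` and `P(B) ⊆ NP(B) ∩ co-NP(B)` for any set `B`",
with `NP(Σₖ) = Σₖ₊₁` by his Thm. 3.1, the quantifier characterisation). In the tree `SigmaP k`
*is* the quantifier form (`PolyHierarchy.lean`: `Σₖ₊₁ = ∃ᵖ·Πₖ`), and `P^{Σₖ}` is the
transcript model of `Oracle.lean`. This file proves, with no hypothesis, the inclusion **two**
levels up,

* `Literature.Computability.Complexity.PRel_ofLanguage_subset_SigmaP_add_two` — `A ∈ Σₖᵖ ⇒ P^A ⊆ Σₖ₊₂ᵖ`;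
* `Literature.Computability.Complexity.PRel_ofLanguage_subset_PiP_add_two` — `A ∈ Σₖᵖ ⇒ P^A ⊆ Πₖ₊₂ᵖ`;
* `Literature.Computability.Complexity.DeltaP_succ_subset_SigmaP_add_two` — `Δₖ₊₁ᵖ ⊆ Σₖ₊₂ᵖ ∩ Πₖ₊₂ᵖ`;
* `Literature.Computability.Complexity.DeltaP_subset_PH` — `Δₖᵖ ⊆ PH` (all `k`),

which is the part of Stockmeyer's diagram consumed by collapse statements of the form
`PH = Δₖᵖ` (e.g. Bremner–Jozsa–Shepherd 2011, Cor. 1: `PH = Δ₃ᵖ`), together with the tool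

* `Literature.Computability.Complexity.compl_mem_PRel` — `P^O` is closed under complement (flip the output bit);
* `Literature.Computability.Complexity.caseSplit_mem_SigmaP` — every `Σₖᵖ` is closed under `P`-guarded case
  distinctions `(S ∩ L₁) ∪ (Sᶜ ∩ L₂)`, `S ∈ P`.

**Not discharged here.** The tree carries the PRINTED one-level form as the named fact
`Literature.QuantumAdvantage.DeltaP_succ_subset_SigmaP_inter_PiP : ∀ k, DeltaP (k+1) ⊆ SigmaP (k+1) ∩
PiP (k+1)` (`QuantumComplexity/IQPPostselection.lean`); the theorems of this file are one level
weaker and do **not** discharge it (that needs certificate lists and a polynomial-time loop, see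
below; a follow-up file does it on top of oracle composition). Consumers that only need
`Δₖ ⊆ PH` (the direction `Δ₃ ⊆ PH` of `PH = Δ₃`) should use `DeltaP_subset_PH`.

## The printed argument and its formalisation

Stockmeyer's one-level inclusion `P(B) ⊆ NP(B)` followed by `NP(Σₖ) ⊆ Σₖ₊₁` (Thm. 3.1, proof:
"guess the sequence of oracle answers, and verify the `yes` answers with the `Σₖ` machine and the
`no` answers with a `Πₖ` computation") needs, in the certificate calculus, lists of certificates
and a polynomial-time loop over the rounds. Going two levels up avoids both: for `L ∈ P^A` decided
by the oracle algorithm `M` with round/query budget `q` (`Oracle.lean`, `PRel`), and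
`A = {y | ∃ c, |c| ≤ p_A |y| ∧ ⟨y, c⟩ ∈ B}` with `Bᶜ ∈ Σₖᵖ` (`exists_rep_of_mem_SigmaP`),

  `x ∈ L ⇔ ∃ as (|as| ≤ q|x|) ∀ z = ⟨tag, ⟨j, c⟩⟩ (|z| ≤ p'|⟨x, as⟩|) : R(⟨⟨x, as⟩, z⟩)`,

where `as ∈ {0,1}*` is the guessed string of one-bit oracle answers and the matrix `R` says, by a
`P`-computable case distinction on `tag`:

* (`tag = ε`) `|as| < q|x|` and the step of `M` after the answers `as` outputs `1`;
* (`tag = 0…`) if `|j| < |as|` then the step of `M` after the first `|j|` answers is a query `y`,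
  and `as_{|j|} = 1 ⇒ y ∈ A`;
* (`tag = 1…`) if `|j| < |as|`, that step is a query `y`, `as_{|j|} = 0` and `|c| ≤ p_A |y|`, then
  `⟨y, c⟩ ∉ B`

(`matrix_iff`). Each case is a Boolean combination of `P` languages with one preimage of `A`
resp. `Bᶜ` under a polynomial-time map, so `R ∈ Σₖᵖ` by the closure of `Σₖᵖ` under `FP`
preimages and under `∩`/`∪` with `P` languages (`SigmaP_closure`, `NPClosureProofs.lean`) and
under `P`-guarded case splits (`caseSplit_mem_SigmaP`, proved here by induction on `k`); hence
`{w | ∀ z …} ∈ ∀ᵖ·Σₖ = Πₖ₊₁` and `L ∈ ∃ᵖ·Πₖ₊₁ = Σₖ₊₂` by definition of the levels. Correctness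
(`mem_iff_exists_forall`) is an induction over the rounds identifying the free-running
transcript of `M` (`PRelSigma.trans`) with the guessed answers (`run_eq_some_iff`,
`mem_queries_of_trans`); the query-length clause of `PRel` bounds the refuting certificates `c`.
All polynomial-time maps are assembled from the tree's string toolkit — pair projections
(`PairProjections.lean`), `copyFn` (`StringCopy.lean`), `mapFstFn`/`mapSndFn`
(`MapFstMachine.lean`, `StringSwap.lean`), `truncSndFn`/`dropSndFn` (`CoinTruncation.lean`),
finite-state transducers (`Transducers.lean`) and machine composition
(`PolyTimeComputable.comp_holds`) — applied to the step machine of `M` (`OracleAlg.IsPolyTime`);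
no new Turing machine is built. The `Π` half follows from closure of `P^A` under complement.

## References

* L. J. Stockmeyer, *The polynomial-time hierarchy*, Theoret. Comput. Sci. 3 (1976) 1–22, §3
  (inclusion structure of `Σₖᵖ, Πₖᵖ, Δₖᵖ`), Thm. 3.1 (quantifier characterisation).
* S. Arora, B. Barak, *Computational Complexity: A Modern Approach*, CUP 2009, Def. 5.3,
  Thm. 5.12 (`Σₖ₊₁ = NP^{Σₖ}`), §5.5 (`Δ` levels), §3.4 (oracle machines).
* M. J. Bremner, R. Jozsa, D. J. Shepherd, Proc. R. Soc. A 467 (2011) 459–472, §3.1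
  (`P^{post-BPP} ⊆ Δ₃ ⊆ PH`, the consumer of `Δ₃ ⊆ PH`).
-/

namespace Literature.Computability.Complexity

open _root_.Computability Polynomial

namespace PRelSigma

/-! ### Free-running transcripts of an oracle algorithm -/

section Transcripts

variable {β : Type}

/-- The query asked by `M` on input `x` after the answers `ans` (junk `[]` if `M` outputs
instead). [Arora–Barak 2009, §3.4] [folklore] -/
def qryOf (M : OracleAlg β) (x : List Bool) (ans : List (List Bool)) : List Bool :=
  match M.step x ans with
  | Sum.inl y => y
  | Sum.inr _ => []

/-- The free-running transcript of `M` with oracle `O` on `x`: the answers received in the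
first `j` rounds (continued with junk queries past an output; only the prefix before the first
output is meaningful). [Arora–Barak 2009, §3.4] [folklore] -/
def trans (M : OracleAlg β) (O : Oracle) (x : List Bool) : ℕ → List (List Bool)
  | 0 => []
  | j + 1 => trans M O x j ++ [O (qryOf M x (trans M O x j))]

/-- `trans` at `0` is the empty transcript. [folklore] -/
@[simp] theorem trans_zero (M : OracleAlg β) (O : Oracle) (x : List Bool) : trans M O x 0 = [] :=
  rfl

/-- One more round of the free-running transcript. [folklore] -/
theorem trans_succ (M : OracleAlg β) (O : Oracle) (x : List Bool) (j : ℕ) :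
    trans M O x (j + 1) = trans M O x j ++ [O (qryOf M x (trans M O x j))] :=
  rfl

/-- If the step after `ans` is the query `y` then `qryOf = y`. [folklore] -/
theorem qryOf_eq_of_step_eq {M : OracleAlg β} {x : List Bool} {ans : List (List Bool)}
    {y : List Bool} (h : M.step x ans = Sum.inl y) : qryOf M x ans = y := by
  simp [qryOf, h]

/-- **The run along the free-running transcript**: started on `trans j` with fuel `n`, the
runner outputs `b` iff for some `m < n` the steps at rounds `j, …, j+m-1` are queries and the
step at round `j+m` outputs `b`. [Arora–Barak 2009, §3.4] [folklore] -/
theorem runAux_trans_eq_some_iff (M : OracleAlg β) (O : Oracle) (x : List Bool) (b : β) :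
    ∀ (n j : ℕ), M.runAux O x n (trans M O x j) = some b ↔
      ∃ m, m < n ∧ (∀ i < m, ∃ y, M.step x (trans M O x (j + i)) = Sum.inl y) ∧
        M.step x (trans M O x (j + m)) = Sum.inr b
  | 0, j => by simp
  | n + 1, j => by
    rw [OracleAlg.runAux_succ]
    cases hs : M.step x (trans M O x j) with
    | inl y =>
      have htr : trans M O x j ++ [O y] = trans M O x (j + 1) := by
        rw [trans_succ, qryOf_eq_of_step_eq hs]
      simp only
      rw [htr, runAux_trans_eq_some_iff M O x b n (j + 1)]
      constructor
      · rintro ⟨m, hm, hall, hfin⟩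
        refine ⟨m + 1, by omega, fun i hi => ?_, by rwa [show j + (m + 1) = j + 1 + m by omega]⟩
        rcases i with _ | i
        · exact ⟨y, by simpa using hs⟩
        · rw [show j + (i + 1) = j + 1 + i by omega]
          exact hall i (by omega)
      · rintro ⟨m, hm, hall, hfin⟩
        rcases m with _ | m
        · rw [add_zero, hs] at hfin
          cases hfin
        · refine ⟨m, by omega, fun i hi => ?_, by rwa [show j + 1 + m = j + (m + 1) by omega]⟩
          rw [show j + 1 + i = j + (i + 1) by omega]
          exact hall (i + 1) (by omega)
    | inr b' =>
      simp only [Option.some.injEq]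
      constructor
      · rintro rfl
        exact ⟨0, by omega, fun i hi => absurd hi (Nat.not_lt_zero _), by simpa using hs⟩
      · rintro ⟨m, -, hall, hfin⟩
        rcases m with _ | m
        · rw [add_zero, hs] at hfin
          simpa using hfin
        · obtain ⟨y, hy⟩ := hall 0 (by omega)
          rw [add_zero, hs] at hy
          cases hy

/-- **The run of an oracle algorithm, unrolled**: `M.run O n x = some b` iff for some `m < n`
the first `m` steps along the free-running transcript are queries and step `m` outputs `b`.
[Arora–Barak 2009, §3.4] [folklore] -/
theorem run_eq_some_iff (M : OracleAlg β) (O : Oracle) (n : ℕ) (x : List Bool) (b : β) :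
    M.run O n x = some b ↔
      ∃ m, m < n ∧ (∀ i < m, ∃ y, M.step x (trans M O x i) = Sum.inl y) ∧
        M.step x (trans M O x m) = Sum.inr b := by
  have h := runAux_trans_eq_some_iff M O x b n 0
  simp only [trans_zero, zero_add] at h
  exact h

/-- The queries along the free-running transcript are recorded by `queriesAux`: if the steps at
rounds `j, …, j+i` are all queries and `i < n`, the query of round `j+i` is in the transcript of
queries. [Arora–Barak 2009, §3.4] [folklore] -/
theorem mem_queriesAux_trans (M : OracleAlg β) (O : Oracle) (x : List Bool) :
    ∀ (n j i : ℕ), i < n → (∀ i' ≤ i, ∃ y, M.step x (trans M O x (j + i')) = Sum.inl y) →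
      qryOf M x (trans M O x (j + i)) ∈ M.queriesAux O x n (trans M O x j)
  | 0, _, _, hi, _ => absurd hi (Nat.not_lt_zero _)
  | n + 1, j, i, hi, hall => by
    obtain ⟨y, hy⟩ := hall 0 (Nat.zero_le _)
    rw [add_zero] at hy
    have htr : trans M O x j ++ [O y] = trans M O x (j + 1) := by
      rw [trans_succ, qryOf_eq_of_step_eq hy]
    unfold OracleAlg.queriesAux
    rw [hy]
    simp only
    rcases i with _ | i
    · rw [add_zero, qryOf_eq_of_step_eq hy]
      exact List.mem_cons_self
    · rw [htr, show j + (i + 1) = j + 1 + i by omega]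
      refine List.mem_cons_of_mem _ (mem_queriesAux_trans M O x n (j + 1) i (by omega) fun i' hi' => ?_)
      rw [show j + 1 + i' = j + (i' + 1) by omega]
      exact hall (i' + 1) (by omega)

/-- If the first `i+1` steps are queries and `i < n`, the query of round `i` belongs to
`M.queries O n x`. [Arora–Barak 2009, §3.4] [folklore] -/
theorem mem_queries_of_trans (M : OracleAlg β) (O : Oracle) (n : ℕ) (x : List Bool) (i : ℕ)
    (hi : i < n) (hall : ∀ i' ≤ i, ∃ y, M.step x (trans M O x i') = Sum.inl y) :
    qryOf M x (trans M O x i) ∈ M.queries O n x := by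
  have h := mem_queriesAux_trans M O x n 0 i hi (fun i' hi' => by simpa using hall i' hi')
  simpa [OracleAlg.queries] using h

/-! ### One-bit transcripts -/

/-- The transcript of one-bit answers read off a bit string: `bitsTrans as = as.map ([·])`
(a language oracle answers with the one-bit strings `encodeBool b = [b]`). [folklore] -/
def bitsTrans (u : List Bool) : List (List Bool) :=
  u.map fun b => [b]

/-- The one-bit transcript of the empty string is empty. [folklore] -/
@[simp] theorem bitsTrans_nil : bitsTrans [] = [] := rfl

/-- `bitsTrans` is a monoid morphism. [folklore] -/
@[simp] theorem bitsTrans_append (u v : List Bool) : bitsTrans (u ++ v) = bitsTrans u ++ bitsTrans v := by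
  simp [bitsTrans]

/-- The one-bit transcript of a single bit. [folklore] -/
@[simp] theorem bitsTrans_singleton (b : Bool) : bitsTrans [b] = [[b]] := rfl

/-- `bitsTrans` preserves length. [folklore] -/
@[simp] theorem length_bitsTrans (u : List Bool) : (bitsTrans u).length = u.length := by
  simp [bitsTrans]

/-- `take (i+1) = take i ++ [getD i]` inside the range. [folklore] -/
theorem take_succ_eq_getD (as : List Bool) {i : ℕ} (hi : i < as.length) :
    as.take (i + 1) = as.take i ++ [as.getD i false] := by
  rw [List.take_add_one, List.getD_eq_getElem?_getD, List.getElem?_eq_getElem hi]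
  rfl

/-- The answer of a language oracle is the one-bit string of the indicator. [folklore] -/
theorem ofLanguage_eq_singleton (A : Language Bool) (y : List Bool) :
    Oracle.ofLanguage A y = [A.boolIndicator y] :=
  rfl

/-- **Guessed answers drive the run.** If for every `i < |as|` the step after the first `i`
guessed answers is a query whose true answer bit is `as_i`, then the free-running transcript of
the first `i ≤ |as|` rounds *is* the first `i` guessed answers. [Stockmeyer 1976, proof of
Thm. 3.1 ("guess the oracle answers")] [folklore] -/
theorem trans_eq_bitsTrans_take (M : OracleAlg β) (A : Language Bool) (x : List Bool)
    (as : List Bool) (m : ℕ) (hm : m ≤ as.length)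
    (hvalid : ∀ i < m, ∃ y, M.step x (bitsTrans (as.take i)) = Sum.inl y ∧
      as.getD i false = A.boolIndicator y) :
    ∀ i ≤ m, trans M (Oracle.ofLanguage A) x i = bitsTrans (as.take i)
  | 0, _ => by simp
  | i + 1, hi => by
    have ih := trans_eq_bitsTrans_take M A x as m hm hvalid i (by omega)
    obtain ⟨y, hy, hbit⟩ := hvalid i (by omega)
    rw [trans_succ, ih, qryOf_eq_of_step_eq hy, ofLanguage_eq_singleton, ← hbit,
      take_succ_eq_getD as (by omega), bitsTrans_append, bitsTrans_singleton]

/-- The answer bits of the true run: `answerBits M A x m = [A(y₀), …, A(y_{m-1})]` for the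
queries `yᵢ` along the free-running transcript. [folklore] -/
noncomputable def answerBits (M : OracleAlg β) (A : Language Bool) (x : List Bool) (m : ℕ) :
    List Bool :=
  (List.range m).map fun i => A.boolIndicator (qryOf M x (trans M (Oracle.ofLanguage A) x i))

/-- There are `m` answer bits for `m` rounds. [folklore] -/
@[simp] theorem length_answerBits (M : OracleAlg β) (A : Language Bool) (x : List Bool) (m : ℕ) :
    (answerBits M A x m).length = m := by
  simp [answerBits]

/-- Prefixes of the answer bits are the answer bits of fewer rounds. [folklore] -/
theorem answerBits_take (M : OracleAlg β) (A : Language Bool) (x : List Bool) {i m : ℕ}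
    (hi : i ≤ m) : (answerBits M A x m).take i = answerBits M A x i := by
  simp [answerBits, ← List.map_take, List.take_range, min_eq_left hi]

/-- The `i`-th answer bit is the indicator of the `i`-th query. [folklore] -/
theorem answerBits_getD (M : OracleAlg β) (A : Language Bool) (x : List Bool) {i m : ℕ}
    (hi : i < m) : (answerBits M A x m).getD i false =
      A.boolIndicator (qryOf M x (trans M (Oracle.ofLanguage A) x i)) := by
  rw [List.getD_eq_getElem?_getD]
  simp [answerBits, List.getElem?_range hi]

/-- One more round of answer bits. [folklore] -/
theorem answerBits_succ (M : OracleAlg β) (A : Language Bool) (x : List Bool) (i : ℕ) :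
    answerBits M A x (i + 1) = answerBits M A x i ++
      [A.boolIndicator (qryOf M x (trans M (Oracle.ofLanguage A) x i))] := by
  simp [answerBits, List.range_succ]

/-- The true transcript is the one-bit transcript of its answer bits. [folklore] -/
theorem trans_eq_bitsTrans_answerBits (M : OracleAlg β) (A : Language Bool) (x : List Bool) :
    ∀ i : ℕ, trans M (Oracle.ofLanguage A) x i = bitsTrans (answerBits M A x i)
  | 0 => by simp [answerBits]
  | i + 1 => by
    rw [trans_succ, trans_eq_bitsTrans_answerBits M A x i, answerBits_succ, bitsTrans_append,
      bitsTrans_singleton, ofLanguage_eq_singleton, ← trans_eq_bitsTrans_answerBits M A x i]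

end Transcripts

end PRelSigma

/-! ### `P`-guarded case distinctions inside `Σₖᵖ` -/

/-- The `P`-guarded case distinction `(S ∩ L₁) ∪ (Sᶜ ∩ L₂)`: "if `x ∈ S` then `x ∈ L₁` else
`x ∈ L₂`". [folklore] -/
def caseSplit (S L₁ L₂ : Language Bool) : Language Bool :=
  (S ⊓ L₁) ⊔ (Sᶜ ⊓ L₂)

/-- Membership in a case distinction. [folklore] -/
theorem mem_caseSplit_iff {S L₁ L₂ : Language Bool} {x : List Bool} :
    x ∈ caseSplit S L₁ L₂ ↔ (x ∈ S → x ∈ L₁) ∧ (x ∉ S → x ∈ L₂) := by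
  change (x ∈ S ∧ x ∈ L₁) ∨ (x ∈ Sᶜ ∧ x ∈ L₂) ↔ _
  have hc : x ∈ Sᶜ ↔ x ∉ S := Iff.rfl
  rw [hc]
  by_cases hx : x ∈ S <;> simp [hx]

/-- The complement of a case distinction is the case distinction of the complements. [folklore] -/
theorem compl_caseSplit (S L₁ L₂ : Language Bool) :
    (caseSplit S L₁ L₂)ᶜ = caseSplit S L₁ᶜ L₂ᶜ := by
  ext x
  have h1 : x ∈ (caseSplit S L₁ L₂)ᶜ ↔ x ∉ caseSplit S L₁ L₂ := Iff.rfl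
  have h2 : ∀ (K : Language Bool), x ∈ Kᶜ ↔ x ∉ K := fun _ => Iff.rfl
  rw [h1, mem_caseSplit_iff, mem_caseSplit_iff, h2, h2]
  by_cases hx : x ∈ S <;> simp [hx]

/-- `P` is closed under `P`-guarded case distinctions. [Arora–Barak 2009, §1.3] [folklore] -/
theorem caseSplit_mem_P {S L₁ L₂ : Language Bool} (hS : S ∈ Classes.P) (h₁ : L₁ ∈ Classes.P) (h₂ : L₂ ∈ Classes.P) :
    caseSplit S L₁ L₂ ∈ Classes.P :=
  union_mem_P (inter_mem_P hS h₁) (inter_mem_P (compl_mem_P_iff.2 hS) h₂)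

/-- **`∃·K` is closed under `P`-guarded case distinctions** when `K` is and `K` absorbs
intersections with `P` languages: witness language
`caseSplit {⟨x,y⟩ | x ∈ S} (LenLe p₁ ⊓ B₁) (LenLe p₂ ⊓ B₂)`, bound `p₁ + p₂`.
[Arora–Barak 2009, Def. 5.3 (closure properties of the levels)] [folklore] -/
theorem caseSplit_mem_polyExists {K : Set (Language Bool)}
    (hKP : ∀ ⦃L₁ L₂ : Language Bool⦄, L₁ ∈ Classes.P → L₂ ∈ K → L₁ ⊓ L₂ ∈ K)
    (hKc : ∀ ⦃S L₁ L₂ : Language Bool⦄, S ∈ Classes.P → L₁ ∈ K → L₂ ∈ K → caseSplit S L₁ L₂ ∈ K)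
    {S L₁ L₂ : Language Bool} (hS : S ∈ Classes.P) (h₁ : L₁ ∈ polyExists K) (h₂ : L₂ ∈ polyExists K) :
    caseSplit S L₁ L₂ ∈ polyExists K := by
  obtain ⟨B₁, hB₁, p₁, hp₁⟩ := h₁
  obtain ⟨B₂, hB₂, p₂, hp₂⟩ := h₂
  set S' : Language Bool := {w | (boolUnpair w).1 ∈ S}
  have hS'P : S' ∈ Classes.P := P_closed_boolUnpair_fst S hS
  refine ⟨caseSplit S' (LenLe p₁ ⊓ B₁) (LenLe p₂ ⊓ B₂),
    hKc hS'P (hKP (LenLe_mem_P p₁) hB₁) (hKP (LenLe_mem_P p₂) hB₂), p₁ + p₂, fun x => ?_⟩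
  have hmem : ∀ y : List Bool,
      boolPair x y ∈ caseSplit S' (LenLe p₁ ⊓ B₁) (LenLe p₂ ⊓ B₂) ↔
        (x ∈ S → y.length ≤ p₁.eval x.length ∧ boolPair x y ∈ B₁) ∧
          (x ∉ S → y.length ≤ p₂.eval x.length ∧ boolPair x y ∈ B₂) := fun y => by
    have e : boolPair x y ∈ S' ↔ x ∈ S := by
      change (boolUnpair (boolPair x y)).1 ∈ S ↔ _
      rw [boolUnpair_boolPair]
    have l1 : boolPair x y ∈ LenLe p₁ ⊓ B₁ ↔ y.length ≤ p₁.eval x.length ∧ boolPair x y ∈ B₁ := by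
      change boolPair x y ∈ LenLe p₁ ∧ boolPair x y ∈ B₁ ↔ _
      rw [boolPair_mem_LenLe]
    have l2 : boolPair x y ∈ LenLe p₂ ⊓ B₂ ↔ y.length ≤ p₂.eval x.length ∧ boolPair x y ∈ B₂ := by
      change boolPair x y ∈ LenLe p₂ ∧ boolPair x y ∈ B₂ ↔ _
      rw [boolPair_mem_LenLe]
    simp only [mem_caseSplit_iff, e, l1, l2]
  rw [mem_caseSplit_iff, hp₁ x, hp₂ x]
  simp only [eval_add]
  by_cases hx : x ∈ S
  · constructor
    · rintro ⟨h, -⟩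
      obtain ⟨y, hy, hyB⟩ := h hx
      exact ⟨y, by omega, (hmem y).2 ⟨fun _ => ⟨hy, hyB⟩, fun h' => absurd hx h'⟩⟩
    · rintro ⟨y, -, hy⟩
      exact ⟨fun _ => ⟨y, ((hmem y).1 hy).1 hx⟩, fun h' => absurd hx h'⟩
  · constructor
    · rintro ⟨-, h⟩
      obtain ⟨y, hy, hyB⟩ := h hx
      exact ⟨y, by omega, (hmem y).2 ⟨fun h' => absurd h' hx, fun _ => ⟨hy, hyB⟩⟩⟩
    · rintro ⟨y, -, hy⟩
      exact ⟨fun h' => absurd h' hx, fun _ => ⟨y, ((hmem y).1 hy).2 hx⟩⟩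

/-- `co K` is closed under `P`-guarded case distinctions when `K` is. [folklore] -/
theorem caseSplit_mem_co {K : Set (Language Bool)}
    (hKc : ∀ ⦃S L₁ L₂ : Language Bool⦄, S ∈ Classes.P → L₁ ∈ K → L₂ ∈ K → caseSplit S L₁ L₂ ∈ K)
    {S L₁ L₂ : Language Bool} (hS : S ∈ Classes.P) (h₁ : L₁ ∈ co K) (h₂ : L₂ ∈ co K) :
    caseSplit S L₁ L₂ ∈ co K := by
  change (caseSplit S L₁ L₂)ᶜ ∈ K
  rw [compl_caseSplit]
  exact hKc hS h₁ h₂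

open PRelSigma

/-- **Every level `Σₖᵖ` is closed under `P`-guarded case distinctions**
`(S ∩ L₁) ∪ (Sᶜ ∩ L₂)` with `S ∈ P` (induction on `k` through `∃·` and `co`, using the closure
of `Σₖᵖ` under `∩`/`∪` with `P` languages, `SigmaP_closure`). [Arora–Barak 2009, Def. 5.3;
Stockmeyer 1976, §3] [cite: Stockmeyer1976, §3] -/
theorem caseSplit_mem_SigmaP (k : ℕ) :
    ∀ ⦃S L₁ L₂ : Language Bool⦄, S ∈ Classes.P → L₁ ∈ SigmaP k → L₂ ∈ SigmaP k →
      caseSplit S L₁ L₂ ∈ SigmaP k := by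
  induction k with
  | zero => exact fun _ _ _ hS h₁ h₂ => caseSplit_mem_P hS h₁ h₂
  | succ k ih =>
    obtain ⟨-, ihi, ihu⟩ := SigmaP_closure k
    intro S L₁ L₂ hS h₁ h₂
    exact caseSplit_mem_polyExists (fun _ _ ha hb => inter_P_mem_co ihu ha hb)
      (fun _ _ _ hS' ha hb => caseSplit_mem_co ih hS' ha hb) hS h₁ h₂

/-- **Normal form of a `Σₖᵖ` language**: `A ∈ Σₖᵖ` is `{y | ∃ c, |c| ≤ p_A |y| ∧ ⟨y, c⟩ ∈ B}` for
a language `B` with `Bᶜ ∈ Σₖᵖ` (for `k = 0` take the dummy witness and `B = {w | w.1 ∈ A}`; for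
`k + 1` this is the definition `Σₖ₊₁ = ∃ᵖ·Πₖ` with `Σₖ ⊆ Σₖ₊₁`). [Arora–Barak 2009, Def. 5.3] [cite: Stockmeyer1976, §3] -/
theorem exists_rep_of_mem_SigmaP {k : ℕ} {A : Language Bool} (hA : A ∈ SigmaP k) :
    ∃ B : Language Bool, Bᶜ ∈ SigmaP k ∧ ∃ pA : Polynomial ℕ, ∀ y : List Bool,
      y ∈ A ↔ ∃ c : List Bool, c.length ≤ pA.eval y.length ∧ boolPair y c ∈ B := by
  cases k with
  | zero =>
    refine ⟨{w | (boolUnpair w).1 ∈ A}, ?_, 0, fun y => ?_⟩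
    · change ({w | (boolUnpair w).1 ∈ A}ᶜ : Language Bool) ∈ Classes.P
      exact compl_mem_P_iff.2 (P_closed_boolUnpair_fst A hA)
    · constructor
      · intro hy
        refine ⟨[], by simp, ?_⟩
        change (boolUnpair (boolPair y [])).1 ∈ A
        rwa [boolUnpair_boolPair]
      · rintro ⟨c, -, hc⟩
        change (boolUnpair (boolPair y c)).1 ∈ A at hc
        rwa [boolUnpair_boolPair] at hc
  | succ k =>
    obtain ⟨B, hB, pA, hpA⟩ := hA
    exact ⟨B, SigmaP_subset_succ_holds k hB, pA, hpA⟩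

/-! ### Pairing and projections of polynomial-time maps -/

/-- `pairFn f g : z ↦ ⟨f z, g z⟩` (copy, map the two halves). [Arora–Barak 2009, Thm. 2.8 (proof)] [folklore] -/
noncomputable def pairFn (f g : List Bool → List Bool) : List Bool → List Bool :=
  mapSndFn g ∘ mapFstFn f ∘ copyFn

/-- `pairFn f g z = ⟨f z, g z⟩`. [folklore] -/
@[simp] theorem pairFn_apply (f g : List Bool → List Bool) (z : List Bool) :
    pairFn f g z = boolPair (f z) (g z) := by
  simp [pairFn, copyFn_apply]

/-- **`pairFn f g ∈ FP`** for `f, g ∈ FP`. [Arora–Barak 2009, Thm. 2.8 (proof)] [folklore] -/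
theorem pairFn_mem_FP {f g : List Bool → List Bool} (hf : f ∈ FP) (hg : g ∈ FP) :
    pairFn f g ∈ FP :=
  comp_mem_FP (mapSndFn_mem_FP hg) (comp_mem_FP (mapFstFn_mem_FP hf) copyFn_mem_FP)

-- Only `pairFn_apply`/`pairFn_mem_FP` are used below; blocking `δ`-reduction keeps definitional
-- unfolding of the matrix languages cheap.
attribute [irreducible] pairFn

/-- First projection of the pairing. [folklore] -/
def fstP : List Bool → List Bool := fun z => (boolUnpair z).1

/-- Second projection of the pairing. [folklore] -/
def sndP : List Bool → List Bool := fun z => (boolUnpair z).2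

/-- First projection of a pair. [folklore] -/
@[simp] theorem fstP_boolPair (x y : List Bool) : fstP (boolPair x y) = x := by simp [fstP]
/-- Second projection of a pair. [folklore] -/
@[simp] theorem sndP_boolPair (x y : List Bool) : sndP (boolPair x y) = y := by simp [sndP]

/-- The first projection is in `FP` (`PairProjections.lean`). [folklore] -/
theorem fstP_mem_FP : fstP ∈ FP := boolUnpairFst_mem_FP
/-- The second projection is in `FP` (`PairProjections.lean`). [folklore] -/
theorem sndP_mem_FP : sndP ∈ FP := boolUnpairSnd_mem_FP


namespace PRelSigma

/-! ### Finite-state tests and maps on strings -/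

section FSTs

/-- Transducer deciding "the first symbol is `b`": the state records the first symbol read.
[Hopcroft–Ullman 1979, §2.7] [folklore] -/
def headT (b : Bool) : FST (Option Bool) Bool Bool where
  init := none
  step := fun s c => (some (s.getD c), [])
  front := fun s => [decide (s = some b)]
  keep := fun _ => false

/-- Once a first symbol is recorded, `headT` keeps it. [folklore] -/
theorem headT_run_some (b d : Bool) (w : List Bool) : ((headT b).run (some d) w).1 = some d := by
  induction w with
  | nil => rfl
  | cons c w ih => rw [FST.run_cons]; exact ih

/-- From the initial state `headT` records `head?`. [folklore] -/
theorem headT_run_none (b : Bool) (w : List Bool) : ((headT b).run none w).1 = w.head? := by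
  cases w with
  | nil => rfl
  | cons c w => rw [FST.run_cons]; exact headT_run_some b c w

/-- `headT b` decides `{s | s.head? = some b}`. [folklore] -/
theorem headT_eval (b : Bool) (w : List Bool) : (headT b).eval w = [decide (w.head? = some b)] := by
  have h := headT_run_none b w
  simp only [FST.eval, show (headT b).init = none from rfl, show ∀ s, (headT b).keep s = false from
    fun _ => rfl, show ∀ s, (headT b).front s = [decide (s = some b)] from fun _ => rfl, h]
  simp

/-- The regular language "first symbol is `b`". [folklore] -/
def HeadIs (b : Bool) : Language Bool :=
  {s | s.head? = some b}

/-- Membership in `HeadIs b` (definitional). [folklore] -/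
@[simp] theorem mem_HeadIs {b : Bool} {s : List Bool} : s ∈ HeadIs b ↔ s.head? = some b := Iff.rfl

/-- **`{s | s.head? = some b} ∈ P`.** [Arora–Barak 2009, Def. 1.13] [folklore] -/
theorem HeadIs_mem_P (b : Bool) : HeadIs b ∈ Classes.P :=
  mem_P_of_mem_FP (headT b).polyTimeComputable_eval _ fun w =>
    ⟨fun h => by rw [headT_eval, decide_eq_true (show w.head? = some b from h)],
     fun h => by rw [headT_eval, decide_eq_false (show ¬ w.head? = some b from h)]⟩

/-- Transducer deciding emptiness of the input. [folklore] -/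
def nilT : FST Bool Bool Bool where
  init := false
  step := fun _ _ => (true, [])
  front := fun s => [!s]
  keep := fun _ => false

/-- `nilT` stays in the state "non-empty". [folklore] -/
theorem nilT_run_true (w : List Bool) : (nilT.run true w).1 = true := by
  induction w with
  | nil => rfl
  | cons c w ih => rw [FST.run_cons]; exact ih

/-- `nilT` decides emptiness. [folklore] -/
theorem nilT_eval (w : List Bool) : nilT.eval w = [decide (w = [])] := by
  have h : (nilT.run false w).1 = decide (w ≠ []) := by
    cases w with
    | nil => rfl
    | cons c w =>
      rw [FST.run_cons, show (nilT.step false c).1 = true from rfl, nilT_run_true]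
      simp
  simp only [FST.eval, show nilT.init = false from rfl, show ∀ s, nilT.keep s = false from
    fun _ => rfl, show ∀ s, nilT.front s = [!s] from fun _ => rfl, h]
  by_cases hw : w = [] <;> simp [hw]

/-- The language `{ε}`. [folklore] -/
def IsNil : Language Bool :=
  {s | s = []}

/-- Membership in `IsNil` (definitional). [folklore] -/
@[simp] theorem mem_IsNil {s : List Bool} : s ∈ IsNil ↔ s = [] := Iff.rfl

/-- **`{ε} ∈ P`.** [Arora–Barak 2009, Def. 1.13] [folklore] -/
theorem IsNil_mem_P : IsNil ∈ Classes.P :=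
  mem_P_of_mem_FP nilT.polyTimeComputable_eval _ fun w =>
    ⟨fun h => by rw [nilT_eval, decide_eq_true (show w = [] from h)],
     fun h => by rw [nilT_eval, decide_eq_false (show ¬ w = [] from h)]⟩

/-- Transducer dropping the first symbol. [folklore] -/
def tailT : FST Bool Bool Bool where
  init := false
  step := fun s c => (true, if s then [c] else [])
  front := fun _ => []
  keep := fun _ => true

/-- After the first symbol `tailT` copies. [folklore] -/
theorem tailT_run_true (w : List Bool) : tailT.run true w = (true, w) := by
  induction w with
  | nil => rfl
  | cons c w ih =>
    rw [FST.run_cons, show tailT.step true c = (true, [c]) from rfl, ih]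
    rfl

/-- `tailT` drops exactly the first symbol. [folklore] -/
theorem tailT_run_false_cons (c : Bool) (w : List Bool) : tailT.run false (c :: w) = (true, w) := by
  rw [FST.run_cons, show tailT.step false c = (true, []) from rfl, tailT_run_true]
  rfl

/-- `tailT` computes `List.tail`. [folklore] -/
theorem tailT_eval (w : List Bool) : tailT.eval w = w.tail := by
  cases w with
  | nil => rfl
  | cons c w =>
    have h := tailT_run_false_cons c w
    simp only [FST.eval, show tailT.init = false from rfl, h, show ∀ s, tailT.keep s = true from
      fun _ => rfl, show ∀ s, tailT.front s = [] from fun _ => rfl]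
    simp

/-- **`List.tail ∈ FP`.** [Arora–Barak 2009, §1.3] [folklore] -/
theorem tail_mem_FP : (List.tail : List Bool → List Bool) ∈ FP := by
  obtain ⟨p, Mx, hM⟩ := tailT.polyTimeComputable_eval
  exact ⟨p, Mx, fun w => by simpa [tailT_eval] using hM w⟩

/-- States of the transcript encoder `encT`: inside the doubled copy (even position / first
symbol of a pair read), or in the tail. [folklore] -/
inductive ES
  | ev0
  | ev1 (b : Bool)
  | tl
  deriving DecidableEq, Fintype

/-- The transcript encoder: on `boolPair u u = dup u ++ 01 ++ u` it emits `11` per doubled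
pair, `01` at the separator, and `b b 0 1` per tail bit `b` — i.e. the `listBool` code of the
one-bit transcript `bitsTrans u` (`encT_eval_boolPair`). [folklore] -/
def encT : FST ES Bool Bool where
  init := ES.ev0
  step := fun s c =>
    match s with
    | ES.ev0 => (ES.ev1 c, [])
    | ES.ev1 b => if b = c then (ES.ev0, [true, true]) else (ES.tl, [false, true])
    | ES.tl => (ES.tl, [c, c, false, true])
  front := fun _ => []
  keep := fun _ => true

/-- The body of the `listBool` code of a one-bit transcript. [folklore] -/
def codeBody (u : List Bool) : List Bool :=
  u.flatMap fun c => [c, c, false, true]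

/-- The code body of `c :: u` starts with the block `c c 0 1`. [folklore] -/
theorem codeBody_cons (c : Bool) (u : List Bool) :
    codeBody (c :: u) = c :: c :: false :: true :: codeBody u := by
  simp [codeBody]

/-- The code body has four symbols per bit. [folklore] -/
theorem length_codeBody (u : List Bool) : (codeBody u).length = 4 * u.length := by
  induction u with
  | nil => rfl
  | cons c u ih =>
    rw [codeBody_cons]
    simp only [List.length_cons, ih]
    omega

/-- In the tail `encT` emits the code body. [folklore] -/
theorem encT_run_tl (u : List Bool) : encT.run ES.tl u = (ES.tl, codeBody u) := by
  induction u with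
  | nil => rfl
  | cons c u ih =>
    rw [FST.run_cons, show encT.step ES.tl c = (ES.tl, [c, c, false, true]) from rfl, ih, codeBody_cons]
    rfl

/-- On a doubled prefix `encT` emits `11` per pair and returns to the even state. [folklore] -/
theorem encT_run_ev0_dup (u l : List Bool) :
    encT.run ES.ev0 ((u.flatMap fun b => [b, b]) ++ l) =
      ((encT.run ES.ev0 l).1, List.replicate (2 * u.length) true ++ (encT.run ES.ev0 l).2) := by
  induction u with
  | nil => simp
  | cons b u ih =>
    simp only [List.flatMap_cons, List.cons_append, List.nil_append, FST.run_cons, List.length_cons]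
    have h1 : encT.step ES.ev0 b = (ES.ev1 b, []) := rfl
    have h2 : encT.step (ES.ev1 b) b = (ES.ev0, [true, true]) := by simp [encT]
    rw [h1]
    simp only [h2]
    rw [ih, Nat.mul_succ, add_comm (2 * u.length) 2, List.replicate_add]
    simp

/-- `encT` on `boolPair u u` emits the `listBool` code shape. [folklore] -/
theorem encT_eval_boolPair (u : List Bool) :
    encT.eval (boolPair u u) = List.replicate (2 * u.length) true ++ false :: true :: codeBody u := by
  have hsep : encT.run ES.ev0 (false :: true :: u) = (ES.tl, false :: true :: codeBody u) := by
    rw [FST.run_cons, show encT.step ES.ev0 false = (ES.ev1 false, []) from rfl]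
    simp only [FST.run_cons, show encT.step (ES.ev1 false) true = (ES.tl, [false, true]) by
      simp [encT], encT_run_tl]
    simp
  have hrun := encT_run_ev0_dup u (false :: true :: u)
  rw [hsep] at hrun
  have hb : boolPair u u = (u.flatMap fun b => [b, b]) ++ (false :: true :: u) := by
    simp [boolPair]
  simp only [FST.eval, show encT.init = ES.ev0 from rfl, show ∀ s, encT.keep s = true from
    fun _ => rfl, show ∀ s, encT.front s = [] from fun _ => rfl, hb, hrun]
  simp

/-- The `listBool` code of the one-bit transcript of `u`. [H21 design C2] [folklore] -/
def codeOf (u : List Bool) : List Bool :=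
  (encodingList Bool).listBool.encode (bitsTrans u)

/-- The iterated pairing of a one-bit transcript is the code body. [folklore] -/
theorem foldr_bitsTrans (u : List Bool) :
    (bitsTrans u).foldr (fun a acc => boolPair ((encodingList Bool).encode a) acc) [] = codeBody u := by
  induction u with
  | nil => rfl
  | cons c u ih =>
    simp only [bitsTrans, List.map_cons, List.foldr_cons] at ih ⊢
    rw [ih]
    simp [boolPair, codeBody, encodingList]

/-- The code of a one-bit transcript, explicitly. [H21 design C2] [folklore] -/
theorem codeOf_eq (u : List Bool) :
    codeOf u = List.replicate (2 * u.length) true ++ false :: true :: codeBody u := by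
  rw [codeOf, show (encodingList Bool).listBool.encode (bitsTrans u) =
    boolPair (unaryEncodeNat (bitsTrans u).length)
      ((bitsTrans u).foldr (fun a acc => boolPair ((encodingList Bool).encode a) acc) []) from rfl,
    foldr_bitsTrans, length_bitsTrans, boolPair_unaryEncodeNat]

/-- **`u ↦ listBool-code of bitsTrans u` is in `FP`** (`encT ∘ copyFn`). [Arora–Barak 2009, §1.3] [folklore] -/
theorem codeOf_mem_FP : codeOf ∈ FP := by
  have h : codeOf = encT.eval ∘ copyFn := by
    funext u
    rw [Function.comp_apply, copyFn_apply, encT_eval_boolPair, codeOf_eq]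
  rw [h]
  exact comp_mem_FP encT.polyTimeComputable_eval copyFn_mem_FP

/-- Length of the code: `|codeOf u| = 6|u| + 2`. [folklore] -/
theorem length_codeOf (u : List Bool) : (codeOf u).length = 6 * u.length + 2 := by
  rw [codeOf_eq]
  simp only [List.length_append, List.length_replicate, List.length_cons, length_codeBody]
  omega

/-- States of the output flipper `flipT`. [folklore] -/
inductive FS
  | st0
  | stT
  | stC
  deriving DecidableEq, Fintype

/-- The output flipper on `sumBool` codes: `0 q ↦ 0 q`, `1 b r ↦ 1 (¬b) r`. [folklore] -/
def flipT : FST FS Bool Bool where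
  init := FS.st0
  step := fun s c =>
    match s with
    | FS.st0 => (if c then FS.stT else FS.stC, [c])
    | FS.stT => (FS.stC, [!c])
    | FS.stC => (FS.stC, [c])
  front := fun _ => []
  keep := fun _ => true

/-- In the copy state `flipT` copies. [folklore] -/
theorem flipT_run_stC (w : List Bool) : flipT.run FS.stC w = (FS.stC, w) := by
  induction w with
  | nil => rfl
  | cons c w ih =>
    rw [FST.run_cons, show flipT.step FS.stC c = (FS.stC, [c]) from rfl, ih]
    rfl

/-- `flipT` fixes codes of queries. [folklore] -/
theorem flipT_eval_false (q : List Bool) : flipT.eval (false :: q) = false :: q := by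
  simp only [FST.eval, show flipT.init = FS.st0 from rfl, show ∀ s, flipT.keep s = true from
    fun _ => rfl, show ∀ s, flipT.front s = [] from fun _ => rfl, FST.run_cons,
    show flipT.step FS.st0 false = (FS.stC, [false]) from rfl, flipT_run_stC]
  simp

/-- `flipT` negates the payload bit of codes of outputs. [folklore] -/
theorem flipT_eval_true (b : Bool) (r : List Bool) :
    flipT.eval (true :: b :: r) = true :: (!b) :: r := by
  simp only [FST.eval, show flipT.init = FS.st0 from rfl, show ∀ s, flipT.keep s = true from
    fun _ => rfl, show ∀ s, flipT.front s = [] from fun _ => rfl, FST.run_cons,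
    show flipT.step FS.st0 true = (FS.stT, [true]) from rfl,
    show flipT.step FS.stT b = (FS.stC, [!b]) from rfl, flipT_run_stC]
  simp

end FSTs

section Pairing

/-! Accessors of `v = ⟨⟨x, as⟩, z⟩` with `z` read as `⟨tg, ⟨j, c⟩⟩`. -/

/-- `x`-component of `⟨⟨x, as⟩, z⟩`. [folklore] -/
def xFn : List Bool → List Bool := fstP ∘ fstP
/-- `as`-component of `⟨⟨x, as⟩, z⟩`. [folklore] -/
def asFn : List Bool → List Bool := sndP ∘ fstP
/-- tag component `(boolUnpair z).1` of `⟨w, z⟩`. [folklore] -/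
def tgFn : List Bool → List Bool := fstP ∘ sndP
/-- index component `j` of `⟨w, ⟨tg, ⟨j, c⟩⟩⟩`. [folklore] -/
def jFn : List Bool → List Bool := fstP ∘ sndP ∘ sndP
/-- certificate component `c` of `⟨w, ⟨tg, ⟨j, c⟩⟩⟩`. [folklore] -/
def cFn : List Bool → List Bool := sndP ∘ sndP ∘ sndP

/-- `xFn ∈ FP`. [folklore] -/
theorem xFn_mem_FP : xFn ∈ FP := comp_mem_FP fstP_mem_FP fstP_mem_FP
/-- `asFn ∈ FP`. [folklore] -/
theorem asFn_mem_FP : asFn ∈ FP := comp_mem_FP sndP_mem_FP fstP_mem_FP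
/-- `tgFn ∈ FP`. [folklore] -/
theorem tgFn_mem_FP : tgFn ∈ FP := comp_mem_FP fstP_mem_FP sndP_mem_FP
/-- `jFn ∈ FP`. [folklore] -/
theorem jFn_mem_FP : jFn ∈ FP := comp_mem_FP fstP_mem_FP (comp_mem_FP sndP_mem_FP sndP_mem_FP)
/-- `cFn ∈ FP`. [folklore] -/
theorem cFn_mem_FP : cFn ∈ FP := comp_mem_FP sndP_mem_FP (comp_mem_FP sndP_mem_FP sndP_mem_FP)

variable (x as z : List Bool)

/-- `xFn` reads `x` off `⟨⟨x, as⟩, z⟩`. [folklore] -/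
@[simp] theorem xFn_apply : xFn (boolPair (boolPair x as) z) = x := by simp [xFn]
/-- `asFn` reads `as` off `⟨⟨x, as⟩, z⟩`. [folklore] -/
@[simp] theorem asFn_apply : asFn (boolPair (boolPair x as) z) = as := by simp [asFn]
/-- `tgFn` reads the tag `(boolUnpair z).1` off `⟨⟨x, as⟩, z⟩`. [folklore] -/
@[simp] theorem tgFn_apply : tgFn (boolPair (boolPair x as) z) = (boolUnpair z).1 := by simp [tgFn, fstP, sndP]
/-- `jFn` reads `j` off `⟨⟨x, as⟩, ⟨tg, ⟨j, c⟩⟩⟩`. [folklore] -/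
@[simp] theorem jFn_apply : jFn (boolPair (boolPair x as) z) = (boolUnpair (boolUnpair z).2).1 := by
  simp [jFn, fstP, sndP]
/-- `cFn` reads `c` off `⟨⟨x, as⟩, ⟨tg, ⟨j, c⟩⟩⟩`. [folklore] -/
@[simp] theorem cFn_apply : cFn (boolPair (boolPair x as) z) = (boolUnpair (boolUnpair z).2).2 := by
  simp [cFn, sndP]

/-- The guessed-answer prefix `as ↾ |j|`. [folklore] -/
noncomputable def preFn : List Bool → List Bool := sndP ∘ truncSndFn X ∘ pairFn jFn asFn

/-- The guessed-answer suffix `as.drop |j|` (its head is the answer bit of round `|j|`). [folklore] -/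
noncomputable def sufFn : List Bool → List Bool := sndP ∘ dropSndFn X ∘ pairFn jFn asFn

/-- `preFn ∈ FP`. [folklore] -/
theorem preFn_mem_FP : preFn ∈ FP :=
  comp_mem_FP sndP_mem_FP (comp_mem_FP (truncSndFn_mem_FP X) (pairFn_mem_FP jFn_mem_FP asFn_mem_FP))

/-- `sufFn ∈ FP`. [folklore] -/
theorem sufFn_mem_FP : sufFn ∈ FP :=
  comp_mem_FP sndP_mem_FP (comp_mem_FP (dropSndFn_mem_FP X) (pairFn_mem_FP jFn_mem_FP asFn_mem_FP))

/-- `preFn` reads the prefix `as ↾ |j|`. [folklore] -/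
@[simp] theorem preFn_apply :
    preFn (boolPair (boolPair x as) z) = as.take (boolUnpair (boolUnpair z).2).1.length := by
  simp [preFn, truncSndFn_boolPair]

/-- `sufFn` reads the suffix `as.drop |j|`. [folklore] -/
@[simp] theorem sufFn_apply :
    sufFn (boolPair (boolPair x as) z) = as.drop (boolUnpair (boolUnpair z).2).1.length := by
  simp [sufFn, dropSndFn_boolPair]

end Pairing

/-! ### The step machine of an oracle algorithm as a string map -/

section Step

variable (M : OracleAlg Bool)

/-- The `sumBool` code of a step result. [H21 design C2] [folklore] -/
def stepCode (r : List Bool ⊕ Bool) : List Bool :=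
  ((encodingList Bool).sumBool encodingBoolBool).encode r

/-- The code of a query is `0 y`. [folklore] -/
@[simp] theorem stepCode_inl (y : List Bool) : stepCode (Sum.inl y) = false :: y := rfl
/-- The code of an output is `1 b`. [folklore] -/
@[simp] theorem stepCode_inr (b : Bool) : stepCode (Sum.inr b) = [true, b] := rfl

/-- The code of the step of `M` at round `|j|` along the guessed answers:
`v ↦ code (M.step x (bitsTrans (as ↾ |j|)))`. [folklore] -/
noncomputable def stepFn (v : List Bool) : List Bool :=
  stepCode (M.step (xFn v) (bitsTrans (preFn v)))

/-- The code of the step of `M` after all guessed answers: `v ↦ code (M.step x (bitsTrans as))`.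
[folklore] -/
def lastFn (v : List Bool) : List Bool :=
  stepCode (M.step (xFn v) (bitsTrans (asFn v)))

/-- A polynomial-time step function, precomposed with polynomial-time string maps producing its
input and transcript, is an `FP` string map. [Arora–Barak 2009, Thm. 2.8 (composition)] [folklore] -/
theorem stepCode_comp_mem_FP (hM : M.IsPolyTime encodingBoolBool) {f g : List Bool → List Bool}
    (hf : f ∈ FP) (hg : g ∈ FP) :
    (fun v => stepCode (M.step (f v) (bitsTrans (g v)))) ∈ FP := by
  have hin : pairFn f (codeOf ∘ g) ∈ FP := pairFn_mem_FP hf (comp_mem_FP codeOf_mem_FP hg)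
  have hG : PolyTimeComputable (id : List Bool → List Bool)
      (fun p : List Bool × List (List Bool) => boolPair p.1 ((encodingList Bool).listBool.encode p.2))
      (fun v => (f v, bitsTrans (g v))) := by
    obtain ⟨p, Mx, h⟩ := hin
    refine ⟨p, Mx, fun v => ?_⟩
    have hv := h v
    simp only [id, pairFn_apply, Function.comp_apply, codeOf] at hv ⊢
    exact hv
  obtain ⟨p, Mx, h⟩ := PolyTimeComputable.comp_holds hM hG
  exact ⟨p, Mx, fun v => h v⟩

/-- `stepFn M ∈ FP` for polynomial-time `M`. [folklore] -/
theorem stepFn_mem_FP (hM : M.IsPolyTime encodingBoolBool) : stepFn M ∈ FP :=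
  stepCode_comp_mem_FP M hM xFn_mem_FP preFn_mem_FP

/-- `lastFn M ∈ FP` for polynomial-time `M`. [folklore] -/
theorem lastFn_mem_FP (hM : M.IsPolyTime encodingBoolBool) : lastFn M ∈ FP :=
  stepCode_comp_mem_FP M hM xFn_mem_FP asFn_mem_FP

variable (x as z : List Bool)

/-- `stepFn` on `⟨⟨x, as⟩, z⟩` is the code of the step at round `|j|`. [folklore] -/
theorem stepFn_apply : stepFn M (boolPair (boolPair x as) z) =
    stepCode (M.step x (bitsTrans (as.take (boolUnpair (boolUnpair z).2).1.length))) := by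
  simp [stepFn]

/-- `lastFn` on `⟨⟨x, as⟩, z⟩` is the code of the step after all of `as`. [folklore] -/
theorem lastFn_apply : lastFn M (boolPair (boolPair x as) z) = stepCode (M.step x (bitsTrans as)) := by
  simp [lastFn]

/-- Reading a step code: it starts with `0` iff the step is a query. [folklore] -/
theorem stepCode_mem_HeadIs_false_iff (r : List Bool ⊕ Bool) :
    stepCode r ∈ HeadIs false ↔ ∃ y, r = Sum.inl y := by
  cases r with
  | inl y => simp
  | inr b => simp

/-- Reading a step code: its tail is the query. [folklore] -/
theorem tail_stepCode_inl (y : List Bool) : (stepCode (Sum.inl y)).tail = y := rfl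

/-- Reading a step code: it is `[1, 1]` iff the step outputs `1`. [folklore] -/
theorem stepCode_output_true_iff (r : List Bool ⊕ Bool) :
    (stepCode r ∈ HeadIs true ∧ (stepCode r).tail ∈ HeadIs true) ↔ r = Sum.inr true := by
  cases r with
  | inl y => simp
  | inr b => cases b <;> simp

end Step

end PRelSigma

namespace PRelSigma

/-! ### The matrix language and its level -/

section Matrix

variable (M : OracleAlg Bool) (A B : Language Bool) (pA q : Polynomial ℕ)

/-- Guard of the final case: `|as| < q |x|`. [folklore] -/
def GA : Language Bool := fstP ⁻¹' LenLt q
/-- The step after all guessed answers outputs `1`. [folklore] -/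
noncomputable def FinT : Language Bool :=
  (lastFn M ⁻¹' HeadIs true) ⊓ ((List.tail ∘ lastFn M) ⁻¹' HeadIs true)
/-- `|j| < |as|`. [folklore] -/
noncomputable def Gj : Language Bool := pairFn asFn jFn ⁻¹' LenLt X
/-- The step of round `|j|` is a query. [folklore] -/
noncomputable def IQ : Language Bool := stepFn M ⁻¹' HeadIs false
/-- The guessed answer of round `|j|` is `1`. [folklore] -/
noncomputable def BT : Language Bool := sufFn ⁻¹' HeadIs true
/-- The guessed answer of round `|j|` is `0`. [folklore] -/
noncomputable def BF : Language Bool := sufFn ⁻¹' HeadIs false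
/-- The query of round `|j|` is in `A`. [folklore] -/
noncomputable def QA : Language Bool := (List.tail ∘ stepFn M) ⁻¹' A
/-- `|c| ≤ p_A |y|` for the query `y` of round `|j|`. [folklore] -/
noncomputable def LC : Language Bool := pairFn (List.tail ∘ stepFn M) cFn ⁻¹' LenLe pA
/-- `⟨y, c⟩ ∉ B` for the query `y` of round `|j|`. [folklore] -/
noncomputable def NB : Language Bool := pairFn (List.tail ∘ stepFn M) cFn ⁻¹' Bᶜ
/-- Tag of the final case (`tag = ε`). [folklore] -/
def TA : Language Bool := tgFn ⁻¹' IsNil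
/-- Tag of the query/`yes` case (`tag = 0…`). [folklore] -/
def TB : Language Bool := tgFn ⁻¹' HeadIs false

/-- Case `ε`: `|as| < q|x|` and the last step outputs `1`. [folklore] -/
noncomputable def caseA : Language Bool := GA q ⊓ FinT M
/-- Case `0…`: if `|j| < |as|` then round `|j|` is a query `y` and `as_{|j|} = 1 ⇒ y ∈ A`. [folklore] -/
noncomputable def caseB : Language Bool := (Gj)ᶜ ⊔ (IQ M ⊓ ((BT)ᶜ ⊔ QA M A))
/-- Case `1…`: if `|j| < |as|`, round `|j|` is a query `y`, `as_{|j|} = 0` and `|c| ≤ p_A|y|`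
then `⟨y, c⟩ ∉ B`. [folklore] -/
noncomputable def caseC : Language Bool := (Gj ⊓ IQ M ⊓ BF ⊓ LC M pA)ᶜ ⊔ NB M B

/-- **The matrix** `R` of the `∃∀`-form of `L ∈ P^A` (module docstring). [Stockmeyer 1976,
proof of Thm. 3.1] [cite: Stockmeyer1976, Thm. 3.1 (proof)] -/
noncomputable def matrixLang : Language Bool :=
  caseSplit TA (caseA M q) (caseSplit TB (caseB M A) (caseC M B pA))

/-- **The matrix is a `Σₖᵖ` language** when `A, Bᶜ ∈ Σₖᵖ` and `M` is polynomial-time.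
[Stockmeyer 1976, proof of Thm. 3.1] [cite: Stockmeyer1976, Thm. 3.1 (proof)] -/
theorem matrixLang_mem_SigmaP {k : ℕ} (hM : M.IsPolyTime encodingBoolBool) (hA : A ∈ SigmaP k)
    (hB : Bᶜ ∈ SigmaP k) : matrixLang M A B pA q ∈ SigmaP k := by
  obtain ⟨hpre, hinter, hunion⟩ := SigmaP_closure k
  have hP : ∀ {L : Language Bool}, L ∈ Classes.P → L ∈ SigmaP k := fun h => P_subset_SigmaP k h
  have hGA : GA q ∈ Classes.P := preimage_mem_P (LenLt_mem_P q) fstP_mem_FP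
  have hFin : FinT M ∈ Classes.P :=
    inter_mem_P (preimage_mem_P (HeadIs_mem_P true) (lastFn_mem_FP M hM))
      (preimage_mem_P (HeadIs_mem_P true) (comp_mem_FP tail_mem_FP (lastFn_mem_FP M hM)))
  have hGj : Gj ∈ Classes.P := preimage_mem_P (LenLt_mem_P X) (pairFn_mem_FP asFn_mem_FP jFn_mem_FP)
  have hIQ : IQ M ∈ Classes.P := preimage_mem_P (HeadIs_mem_P false) (stepFn_mem_FP M hM)
  have hBT : BT ∈ Classes.P := preimage_mem_P (HeadIs_mem_P true) sufFn_mem_FP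
  have hBF : BF ∈ Classes.P := preimage_mem_P (HeadIs_mem_P false) sufFn_mem_FP
  have hqry : (List.tail ∘ stepFn M) ∈ FP := comp_mem_FP tail_mem_FP (stepFn_mem_FP M hM)
  have hQA : QA M A ∈ SigmaP k := hpre hA hqry
  have hLC : LC M pA ∈ Classes.P := preimage_mem_P (LenLe_mem_P pA) (pairFn_mem_FP hqry cFn_mem_FP)
  have hNB : NB M B ∈ SigmaP k := hpre hB (pairFn_mem_FP hqry cFn_mem_FP)
  have hTA : TA ∈ Classes.P := preimage_mem_P IsNil_mem_P tgFn_mem_FP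
  have hTB : TB ∈ Classes.P := preimage_mem_P (HeadIs_mem_P false) tgFn_mem_FP
  have hcA : caseA M q ∈ SigmaP k := hP (inter_mem_P hGA hFin)
  have hcB : caseB M A ∈ SigmaP k :=
    hunion (compl_mem_P_iff.2 hGj) (hinter hIQ (hunion (compl_mem_P_iff.2 hBT) hQA))
  have hcC : caseC M B pA ∈ SigmaP k :=
    hunion (compl_mem_P_iff.2 (inter_mem_P (inter_mem_P (inter_mem_P hGj hIQ) hBF) hLC)) hNB
  exact caseSplit_mem_SigmaP k hTA hcA (caseSplit_mem_SigmaP k hTB hcB hcC)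

/-! #### Reading the matrix -/

/-- Condition of case `ε`. [folklore] -/
def CondA (x as : List Bool) : Prop :=
  as.length < q.eval x.length ∧ M.step x (bitsTrans as) = Sum.inr true

/-- Condition of case `0…` at round `j`. [folklore] -/
def CondB (x as : List Bool) (j : ℕ) : Prop :=
  j < as.length → ∃ y, M.step x (bitsTrans (as.take j)) = Sum.inl y ∧
    ((as.drop j).head? = some true → y ∈ A)

/-- Condition of case `1…` at round `j` with certificate `c`. [folklore] -/
def CondC (x as : List Bool) (j : ℕ) (c : List Bool) : Prop :=
  ∀ y, M.step x (bitsTrans (as.take j)) = Sum.inl y → j < as.length →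
    (as.drop j).head? = some false → c.length ≤ pA.eval y.length → boolPair y c ∉ B

variable (x as z : List Bool)

/-- Reading `GA`: `|as| < q|x|`. [folklore] -/
theorem mem_GA_iff : boolPair (boolPair x as) z ∈ GA q ↔ as.length < q.eval x.length := by
  change fstP (boolPair (boolPair x as) z) ∈ LenLt q ↔ _
  rw [fstP_boolPair, boolPair_mem_LenLt]

/-- Reading `FinT`: the last step outputs `1`. [folklore] -/
theorem mem_FinT_iff : boolPair (boolPair x as) z ∈ FinT M ↔ M.step x (bitsTrans as) = Sum.inr true := by
  change lastFn M (boolPair (boolPair x as) z) ∈ HeadIs true ∧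
    (lastFn M (boolPair (boolPair x as) z)).tail ∈ HeadIs true ↔ _
  rw [lastFn_apply, stepCode_output_true_iff]

/-- Reading `Gj`: `|j| < |as|`. [folklore] -/
theorem mem_Gj_iff : boolPair (boolPair x as) z ∈ Gj ↔
    (boolUnpair (boolUnpair z).2).1.length < as.length := by
  change pairFn asFn jFn (boolPair (boolPair x as) z) ∈ LenLt X ↔ _
  simp only [pairFn_apply, asFn_apply, jFn_apply, boolPair_mem_LenLt, eval_X]

/-- Reading `IQ`: round `|j|` is a query. [folklore] -/
theorem mem_IQ_iff : boolPair (boolPair x as) z ∈ IQ M ↔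
    ∃ y, M.step x (bitsTrans (as.take (boolUnpair (boolUnpair z).2).1.length)) = Sum.inl y := by
  change stepFn M (boolPair (boolPair x as) z) ∈ HeadIs false ↔ _
  rw [stepFn_apply, stepCode_mem_HeadIs_false_iff]

/-- Reading `BT`: the answer bit of round `|j|` is `1`. [folklore] -/
theorem mem_BT_iff : boolPair (boolPair x as) z ∈ BT ↔
    (as.drop (boolUnpair (boolUnpair z).2).1.length).head? = some true := by
  change sufFn (boolPair (boolPair x as) z) ∈ HeadIs true ↔ _
  rw [sufFn_apply, mem_HeadIs]

/-- Reading `BF`: the answer bit of round `|j|` is `0`. [folklore] -/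
theorem mem_BF_iff : boolPair (boolPair x as) z ∈ BF ↔
    (as.drop (boolUnpair (boolUnpair z).2).1.length).head? = some false := by
  change sufFn (boolPair (boolPair x as) z) ∈ HeadIs false ↔ _
  rw [sufFn_apply, mem_HeadIs]

/-- Reading `QA`: the query of round `|j|` is in `A`. [folklore] -/
theorem mem_QA_iff : boolPair (boolPair x as) z ∈ QA M A ↔
    (stepCode (M.step x (bitsTrans (as.take (boolUnpair (boolUnpair z).2).1.length)))).tail ∈ A := by
  change (stepFn M (boolPair (boolPair x as) z)).tail ∈ A ↔ _
  rw [stepFn_apply]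

/-- Reading `LC`: `|c| ≤ p_A |y|`. [folklore] -/
theorem mem_LC_iff : boolPair (boolPair x as) z ∈ LC M pA ↔
    (boolUnpair (boolUnpair z).2).2.length ≤ pA.eval
      (stepCode (M.step x (bitsTrans (as.take (boolUnpair (boolUnpair z).2).1.length)))).tail.length := by
  change pairFn (List.tail ∘ stepFn M) cFn (boolPair (boolPair x as) z) ∈ LenLe pA ↔ _
  rw [pairFn_apply, Function.comp_apply, stepFn_apply, cFn_apply, boolPair_mem_LenLe]

/-- Reading `NB`: `⟨y, c⟩ ∉ B`. [folklore] -/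
theorem mem_NB_iff : boolPair (boolPair x as) z ∈ NB M B ↔
    boolPair (stepCode (M.step x (bitsTrans (as.take (boolUnpair (boolUnpair z).2).1.length)))).tail
      (boolUnpair (boolUnpair z).2).2 ∉ B := by
  change pairFn (List.tail ∘ stepFn M) cFn (boolPair (boolPair x as) z) ∈ Bᶜ ↔ _
  rw [pairFn_apply, Function.comp_apply, stepFn_apply, cFn_apply]
  rfl

/-- Reading the tag of case `ε`. [folklore] -/
theorem mem_TA_iff : boolPair (boolPair x as) z ∈ TA ↔ (boolUnpair z).1 = [] := by
  change tgFn (boolPair (boolPair x as) z) ∈ IsNil ↔ _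
  rw [tgFn_apply, mem_IsNil]

/-- Reading the tag of case `0…`. [folklore] -/
theorem mem_TB_iff : boolPair (boolPair x as) z ∈ TB ↔ (boolUnpair z).1.head? = some false := by
  change tgFn (boolPair (boolPair x as) z) ∈ HeadIs false ↔ _
  rw [tgFn_apply, mem_HeadIs]

/-- Reading case `ε`. [folklore] -/
theorem mem_caseA_iff : boolPair (boolPair x as) z ∈ caseA M q ↔ CondA M q x as := by
  change _ ∈ GA q ∧ _ ∈ FinT M ↔ _
  rw [mem_GA_iff, mem_FinT_iff]
  rfl

/-- Reading case `0…`. [folklore] -/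
theorem mem_caseB_iff : boolPair (boolPair x as) z ∈ caseB M A ↔
    CondB M A x as (boolUnpair (boolUnpair z).2).1.length := by
  change (¬ _ ∈ Gj) ∨ (_ ∈ IQ M ∧ ((¬ _ ∈ BT) ∨ _ ∈ QA M A)) ↔ _
  rw [mem_Gj_iff, mem_IQ_iff, mem_BT_iff, mem_QA_iff]
  unfold CondB
  constructor
  · rintro (h | ⟨⟨y, hy⟩, h⟩)
    · exact fun hj => absurd hj h
    · refine fun _ => ⟨y, hy, fun hb => ?_⟩
      rcases h with h | h
      · exact absurd hb h
      · rwa [hy, tail_stepCode_inl] at h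
  · intro h
    by_cases hj : (boolUnpair (boolUnpair z).2).1.length < as.length
    · obtain ⟨y, hy, hyA⟩ := h hj
      refine Or.inr ⟨⟨y, hy⟩, ?_⟩
      by_cases hb : (as.drop (boolUnpair (boolUnpair z).2).1.length).head? = some true
      · right
        rw [hy, tail_stepCode_inl]
        exact hyA hb
      · exact Or.inl hb
    · exact Or.inl hj

/-- Reading case `1…`. [folklore] -/
theorem mem_caseC_iff : boolPair (boolPair x as) z ∈ caseC M B pA ↔
    CondC M B pA x as (boolUnpair (boolUnpair z).2).1.length (boolUnpair (boolUnpair z).2).2 := by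
  change (¬ (((_ ∈ Gj ∧ _ ∈ IQ M) ∧ _ ∈ BF) ∧ _ ∈ LC M pA)) ∨ _ ∈ NB M B ↔ _
  rw [mem_Gj_iff, mem_IQ_iff, mem_BF_iff, mem_LC_iff, mem_NB_iff]
  unfold CondC
  constructor
  · rintro h y hy hj hb hc
    rw [hy, tail_stepCode_inl] at h
    rcases h with h | h
    · exact absurd ⟨⟨⟨hj, y, rfl⟩, hb⟩, hc⟩ h
    · exact h
  · intro h
    by_cases hall : (((boolUnpair (boolUnpair z).2).1.length < as.length ∧
        ∃ y, M.step x (bitsTrans (as.take (boolUnpair (boolUnpair z).2).1.length)) = Sum.inl y) ∧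
        (as.drop (boolUnpair (boolUnpair z).2).1.length).head? = some false) ∧
        (boolUnpair (boolUnpair z).2).2.length ≤ pA.eval
          (stepCode (M.step x (bitsTrans (as.take (boolUnpair (boolUnpair z).2).1.length)))).tail.length
    · obtain ⟨⟨⟨hj, y, hy⟩, hb⟩, hc⟩ := hall
      right
      rw [hy, tail_stepCode_inl] at hc ⊢
      exact h y hy hj hb hc
    · exact Or.inl hall

/-- **Reading the matrix**: membership of `⟨⟨x, as⟩, z⟩` in `R` is the case distinction on the tag
`(boolUnpair z).1` of the three conditions. [Stockmeyer 1976, proof of Thm. 3.1] [cite: Stockmeyer1976, Thm. 3.1 (proof)] -/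
theorem mem_matrixLang_iff : boolPair (boolPair x as) z ∈ matrixLang M A B pA q ↔
    ((boolUnpair z).1 = [] → CondA M q x as) ∧
    ((boolUnpair z).1 ≠ [] →
      ((boolUnpair z).1.head? = some false → CondB M A x as (boolUnpair (boolUnpair z).2).1.length) ∧
      ((boolUnpair z).1.head? ≠ some false →
        CondC M B pA x as (boolUnpair (boolUnpair z).2).1.length (boolUnpair (boolUnpair z).2).2)) := by
  unfold matrixLang
  rw [mem_caseSplit_iff, mem_caseSplit_iff, mem_TA_iff, mem_TB_iff, mem_caseA_iff, mem_caseB_iff,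
    mem_caseC_iff]

end Matrix

/-! ### Correctness of the `∃∀`-form -/

section Correctness

variable (M : OracleAlg Bool) (A B : Language Bool) (pA q : Polynomial ℕ)

/-- The `Πₖ₊₁` language `{w | ∀ z, |z| ≤ p'|w| → ⟨w, z⟩ ∈ R}`. [Stockmeyer 1976, Thm. 3.1] [cite: Stockmeyer1976, Thm. 3.1 (proof)] -/
noncomputable def allLang (p' : Polynomial ℕ) : Language Bool :=
  {w | ∀ z : List Bool, z.length ≤ p'.eval w.length → boolPair w z ∈ matrixLang M A B pA q}

/-- `allLang ∈ ∀ᵖ·Σₖ` as soon as the matrix is in `Σₖ` (by definition of `∀ᵖ`). [Arora–Barak 2009, Def. 5.3] [folklore] -/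
theorem allLang_mem_polyForall {K : Set (Language Bool)} (hR : matrixLang M A B pA q ∈ K)
    (p' : Polynomial ℕ) : allLang M A B pA q p' ∈ polyForall K :=
  mem_polyForall_iff.2 ⟨matrixLang M A B pA q, hR, p', fun _ => Iff.rfl⟩

/-- The bound on the universally quantified string: `p' = 6 + 2q + p_A ∘ q`. [folklore] -/
noncomputable def zBound : Polynomial ℕ :=
  C 6 + C 2 * q + pA.comp q

/-- Evaluation of the bound polynomial. [folklore] -/
theorem zBound_eval (n : ℕ) : (zBound pA q).eval n = 6 + 2 * q.eval n + pA.eval (q.eval n) := by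
  simp [zBound, eval_comp]

/-- The instance of case `ε`. [folklore] -/
def zA : List Bool := boolPair [] []
/-- The instance of case `0…` at round `i`. [folklore] -/
def zB (i : ℕ) : List Bool := boolPair [false] (boolPair (List.replicate i true) [])
/-- The instance of case `1…` at round `i` with certificate `c`. [folklore] -/
def zC (i : ℕ) (c : List Bool) : List Bool := boolPair [true] (boolPair (List.replicate i true) c)

/-- Length of the case-`ε` instance. [folklore] -/
@[simp] theorem length_zA : zA.length = 2 := by simp [zA]
/-- Length of the case-`0` instance. [folklore] -/
@[simp] theorem length_zB (i : ℕ) : (zB i).length = 2 * i + 6 := by simp [zB]; omega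
/-- Length of the case-`1` instance. [folklore] -/
@[simp] theorem length_zC (i : ℕ) (c : List Bool) : (zC i c).length = 2 * i + 6 + c.length := by
  simp [zC]; omega

variable {M A B pA q}

/-- **Soundness of the `∃∀`-form**: if `⟨x, as⟩` satisfies the matrix for all `z` up to the bound,
then the guessed answers are the true ones, the run of `M` outputs `1`, and `x ∈ L`.
[Stockmeyer 1976, proof of Thm. 3.1] [cite: Stockmeyer1976, Thm. 3.1 (proof)] -/
theorem mem_of_allLang (hpA : ∀ y : List Bool, y ∈ A ↔ ∃ c : List Bool,
      c.length ≤ pA.eval y.length ∧ boolPair y c ∈ B)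
    {L : Language Bool}
    (hq : ∀ x : List Bool, M.run (Oracle.ofLanguage A) (q.eval x.length) x = some (L.boolIndicator x) ∧
      ∀ y ∈ M.queries (Oracle.ofLanguage A) (q.eval x.length) x, y.length ≤ q.eval x.length)
    {x as : List Bool} (has : as.length ≤ q.eval x.length)
    (hall : ∀ z : List Bool, z.length ≤ (zBound pA q).eval (boolPair x as).length →
      boolPair (boolPair x as) z ∈ matrixLang M A B pA q) : x ∈ L := by
  set O := Oracle.ofLanguage A with hO
  have hxw : x.length ≤ (boolPair x as).length := by rw [length_boolPair]; omega
  have hqw : q.eval x.length ≤ q.eval (boolPair x as).length := TM2Iter.eval_mono q hxw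
  have hbound : ∀ (i : ℕ) (c : List Bool), i ≤ q.eval x.length → c.length ≤ pA.eval (q.eval x.length) →
      2 * i + 6 + c.length ≤ (zBound pA q).eval (boolPair x as).length := by
    intro i c hi hc
    rw [zBound_eval]
    have := TM2Iter.eval_mono pA hqw
    omega
  -- case ε
  have hA : CondA M q x as := by
    have h := hall zA (by
      have := hbound 0 [] (Nat.zero_le _) (by simp)
      simp only [List.length_nil, length_zA] at this ⊢
      omega)
    rw [mem_matrixLang_iff] at h
    exact h.1 (by simp [zA])
  -- validity of the guessed answers, by strong induction over the rounds
  have hvalid : ∀ i < as.length, ∃ y, M.step x (bitsTrans (as.take i)) = Sum.inl y ∧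
      as.getD i false = A.boolIndicator y := by
    intro i
    induction i using Nat.strong_induction_on with
    | _ i IH =>
      intro hi
      -- case `0…` at round `i`
      have hBz := hall (zB i) (by rw [length_zB]; exact hbound i [] (by omega) (by simp))
      rw [mem_matrixLang_iff] at hBz
      have hB : CondB M A x as i := by
        have := (hBz.2 (by simp [zB])).1 (by simp [zB])
        simpa [zB] using this
      obtain ⟨y, hy, hyes⟩ := hB hi
      -- the first `i` rounds follow the guessed answers, so `y` is a genuine query
      have htr : ∀ i' ≤ i, trans M O x i' = bitsTrans (as.take i') :=
        trans_eq_bitsTrans_take M A x as i (by omega) (fun i' hi' => IH i' hi' (by omega))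
      have hsteps : ∀ i' ≤ i, ∃ y', M.step x (trans M O x i') = Sum.inl y' := by
        intro i' hi'
        rw [htr i' hi']
        rcases Nat.lt_or_ge i' i with h | h
        · obtain ⟨y', hy', -⟩ := IH i' h (by omega)
          exact ⟨y', hy'⟩
        · obtain rfl : i' = i := le_antisymm hi' h
          exact ⟨y, hy⟩
      have hyq : y ∈ M.queries O (q.eval x.length) x := by
        have h := mem_queries_of_trans M O (q.eval x.length) x i (by omega) hsteps
        rwa [htr i le_rfl, qryOf_eq_of_step_eq hy] at h
      have hylen : y.length ≤ q.eval x.length := (hq x).2 y hyq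
      refine ⟨y, hy, ?_⟩
      -- the answer bit
      have hget : (as.drop i).head? = some (as.getD i false) := by
        rw [List.head?_drop, List.getD_eq_getElem?_getD, List.getElem?_eq_getElem hi]
        rfl
      cases hb : as.getD i false with
      | true =>
        rw [hb] at hget
        exact ((Set.mem_iff_boolIndicator _ _).1 (hyes hget)).symm
      | false =>
        rw [hb] at hget
        symm
        rw [← Bool.not_eq_true, ← Set.mem_iff_boolIndicator]
        intro hyA
        obtain ⟨c, hc, hcB⟩ := (hpA y).1 hyA
        have hCz := hall (zC i c) (by
          rw [length_zC]
          exact hbound i c (by omega) (hc.trans (TM2Iter.eval_mono pA hylen)))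
        rw [mem_matrixLang_iff] at hCz
        have hC : CondC M B pA x as i c := by
          have := (hCz.2 (by simp [zC])).2 (by simp [zC])
          simpa [zC] using this
        exact hC y hy hi hget hc hcB
  -- hence the whole run follows the guessed answers and outputs `1`
  have htr : ∀ i ≤ as.length, trans M O x i = bitsTrans (as.take i) :=
    trans_eq_bitsTrans_take M A x as as.length le_rfl hvalid
  have hrun : M.run O (q.eval x.length) x = some true := by
    rw [run_eq_some_iff]
    refine ⟨as.length, hA.1, fun i hi => ?_, ?_⟩
    · obtain ⟨y, hy, -⟩ := hvalid i hi
      exact ⟨y, by rw [htr i hi.le]; exact hy⟩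
    · rw [htr as.length le_rfl, List.take_length]
      exact hA.2
  have h := (hq x).1
  rw [hrun, Option.some.injEq] at h
  exact (Set.mem_iff_boolIndicator _ _).2 h.symm

/-- **Completeness of the `∃∀`-form**: if `x ∈ L` then the true answer bits `as` of the run
(`answerBits`) satisfy the matrix for every `z`. [Stockmeyer 1976, proof of Thm. 3.1] [cite: Stockmeyer1976, Thm. 3.1 (proof)] -/
theorem allLang_of_mem (hpA : ∀ y : List Bool, y ∈ A ↔ ∃ c : List Bool,
      c.length ≤ pA.eval y.length ∧ boolPair y c ∈ B)
    {L : Language Bool}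
    (hq : ∀ x : List Bool, M.run (Oracle.ofLanguage A) (q.eval x.length) x = some (L.boolIndicator x) ∧
      ∀ y ∈ M.queries (Oracle.ofLanguage A) (q.eval x.length) x, y.length ≤ q.eval x.length)
    {x : List Bool} (hx : x ∈ L) :
    ∃ as : List Bool, as.length ≤ q.eval x.length ∧
      ∀ z : List Bool, boolPair (boolPair x as) z ∈ matrixLang M A B pA q := by
  set O := Oracle.ofLanguage A with hO
  have hrun : M.run O (q.eval x.length) x = some true := by
    rw [(hq x).1, (Set.mem_iff_boolIndicator _ _).1 hx]
  obtain ⟨m, hm, hsteps, hfin⟩ := (run_eq_some_iff M O _ x true).1 hrun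
  refine ⟨answerBits M A x m, by rw [length_answerBits]; exact hm.le, fun z => ?_⟩
  have htr : ∀ i ≤ m, bitsTrans ((answerBits M A x m).take i) = trans M O x i := fun i hi => by
    rw [answerBits_take M A x hi, ← trans_eq_bitsTrans_answerBits]
  rw [mem_matrixLang_iff]
  refine ⟨fun _ => ⟨by simpa using hm, ?_⟩, fun _ => ⟨fun _ hj => ?_, fun _ y hy hj hb hc hcB => ?_⟩⟩
  · -- last step
    have := htr m le_rfl
    rw [List.take_of_length_le (by simp)] at this
    rw [this]
    exact hfin
  · -- a query round, `yes` answers are correct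
    rw [length_answerBits] at hj
    obtain ⟨y, hy⟩ := hsteps _ hj
    refine ⟨y, by rw [htr _ hj.le]; exact hy, fun hb => ?_⟩
    rw [List.head?_drop, List.getElem?_eq_getElem (by simpa using hj)] at hb
    have hget := answerBits_getD M A x (i := (boolUnpair (boolUnpair z).2).1.length) hj
    rw [List.getD_eq_getElem?_getD, List.getElem?_eq_getElem (by simpa using hj)] at hget
    simp only [Option.some.injEq, Option.getD_some] at hb hget
    rw [hb, qryOf_eq_of_step_eq hy] at hget
    exact (Set.mem_iff_boolIndicator _ _).2 hget.symm
  · -- `no` answers are correct: no certificate puts the query into `A`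
    rw [length_answerBits] at hj
    rw [htr _ hj.le] at hy
    rw [List.head?_drop, List.getElem?_eq_getElem (by simpa using hj)] at hb
    have hget := answerBits_getD M A x (i := (boolUnpair (boolUnpair z).2).1.length) hj
    rw [List.getD_eq_getElem?_getD, List.getElem?_eq_getElem (by simpa using hj)] at hget
    simp only [Option.some.injEq, Option.getD_some] at hb hget
    rw [hb, qryOf_eq_of_step_eq hy] at hget
    have hyA : y ∉ A := fun h => by
      have := (Set.mem_iff_boolIndicator _ _).1 h
      rw [← hget] at this
      exact Bool.false_ne_true this
    exact hyA ((hpA y).2 ⟨_, hc, hcB⟩)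

/-- **The `∃∀`-form of `L ∈ P^A`.** [Stockmeyer 1976, proof of Thm. 3.1] [cite: Stockmeyer1976, Thm. 3.1 (proof)] -/
theorem mem_iff_exists_allLang (hpA : ∀ y : List Bool, y ∈ A ↔ ∃ c : List Bool,
      c.length ≤ pA.eval y.length ∧ boolPair y c ∈ B)
    {L : Language Bool}
    (hq : ∀ x : List Bool, M.run (Oracle.ofLanguage A) (q.eval x.length) x = some (L.boolIndicator x) ∧
      ∀ y ∈ M.queries (Oracle.ofLanguage A) (q.eval x.length) x, y.length ≤ q.eval x.length)
    (x : List Bool) :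
    x ∈ L ↔ ∃ as : List Bool, as.length ≤ q.eval x.length ∧
      boolPair x as ∈ allLang M A B pA q (zBound pA q) := by
  constructor
  · intro hx
    obtain ⟨as, has, hall⟩ := allLang_of_mem hpA hq hx
    exact ⟨as, has, fun z _ => hall z⟩
  · rintro ⟨as, has, hall⟩
    exact mem_of_allLang hpA hq has hall

end Correctness

/-! ### Closure of `P^O` under complement -/

section Flip

/-- The oracle algorithm with flipped output bit. [Baker–Gill–Solovay 1975, §1] [folklore] -/
def flipAlg (M : OracleAlg Bool) : OracleAlg Bool where
  step x ans := Sum.map id (fun b => !b) (M.step x ans)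

/-- The step of the flipped algorithm (definitional). [folklore] -/
theorem flipAlg_step (M : OracleAlg Bool) (x : List Bool) (ans : List (List Bool)) :
    (flipAlg M).step x ans = Sum.map id (fun b => !b) (M.step x ans) :=
  rfl

/-- The flipped algorithm runs like `M` with negated output. [folklore] -/
theorem runAux_flipAlg (M : OracleAlg Bool) (O : Oracle) (x : List Bool) :
    ∀ (n : ℕ) (ans : List (List Bool)),
      (flipAlg M).runAux O x n ans = (M.runAux O x n ans).map fun b => !b
  | 0, _ => rfl
  | n + 1, ans => by
    rw [OracleAlg.runAux_succ, OracleAlg.runAux_succ, flipAlg_step]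
    cases M.step x ans with
    | inl q =>
      simp only [Sum.map_inl, id]
      exact runAux_flipAlg M O x n (ans ++ [O q])
    | inr b => simp

/-- The flipped algorithm asks the same queries. [folklore] -/
theorem queriesAux_flipAlg (M : OracleAlg Bool) (O : Oracle) (x : List Bool) :
    ∀ (n : ℕ) (ans : List (List Bool)), (flipAlg M).queriesAux O x n ans = M.queriesAux O x n ans
  | 0, _ => rfl
  | n + 1, ans => by
    unfold OracleAlg.queriesAux
    rw [flipAlg_step]
    cases M.step x ans with
    | inl q =>
      simp only [Sum.map_inl, id]
      exact congrArg _ (queriesAux_flipAlg M O x n (ans ++ [O q]))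
    | inr b => simp

/-- Flipping the output bit is polynomial-time on `sumBool` codes (`flipT`). [folklore] -/
theorem polyTimeComputable_sumMap_not :
    PolyTimeComputable ((encodingList Bool).sumBool encodingBoolBool).encode
      ((encodingList Bool).sumBool encodingBoolBool).encode
      (Sum.map id fun b => !b : List Bool ⊕ Bool → List Bool ⊕ Bool) := by
  obtain ⟨p, Mx, h⟩ := flipT.polyTimeComputable_eval
  refine ⟨p, Mx, fun r => ?_⟩
  have hr := h (((encodingList Bool).sumBool encodingBoolBool).encode r)
  cases r with
  | inl y =>
    have h1 : ((encodingList Bool).sumBool encodingBoolBool).encode (Sum.inl y : List Bool ⊕ Bool) =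
        false :: y := rfl
    have h2 : ((encodingList Bool).sumBool encodingBoolBool).encode
        (Sum.map id (fun b => !b) (Sum.inl y : List Bool ⊕ Bool)) = false :: y := rfl
    rw [h2]
    rw [h1] at hr ⊢
    rwa [flipT_eval_false] at hr
  | inr b =>
    have h1 : ((encodingList Bool).sumBool encodingBoolBool).encode (Sum.inr b : List Bool ⊕ Bool) =
        [true, b] := rfl
    have h2 : ((encodingList Bool).sumBool encodingBoolBool).encode
        (Sum.map id (fun b => !b) (Sum.inr b : List Bool ⊕ Bool)) = [true, !b] := rfl
    rw [h2]
    rw [h1] at hr ⊢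
    rwa [flipT_eval_true] at hr

/-- The flipped algorithm is polynomial-time when `M` is (compose the step machine with `flipT`). [Arora–Barak 2009, Thm. 2.8 (composition)] [folklore] -/
theorem isPolyTime_flipAlg {M : OracleAlg Bool} (hM : M.IsPolyTime encodingBoolBool) :
    (flipAlg M).IsPolyTime encodingBoolBool := by
  have h := PolyTimeComputable.comp_holds polyTimeComputable_sumMap_not hM
  have e : (Sum.map id (fun b => !b) ∘ Function.uncurry M.step) = Function.uncurry (flipAlg M).step := by
    funext p
    rfl
  rw [e] at h
  exact h

end Flip

end PRelSigma

/-- **`P^O` is closed under complement** (flip the output bit of the oracle algorithm; the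
transcript, hence the budget, is unchanged). [Baker–Gill–Solovay 1975, §1] [cite: BakerGillSolovay1975, §1] -/
theorem compl_mem_PRel {O : Oracle} {L : Language Bool} (hL : L ∈ PRel O) : Lᶜ ∈ PRel O := by
  obtain ⟨M, hM, q, hq⟩ := hL
  refine ⟨PRelSigma.flipAlg M, PRelSigma.isPolyTime_flipAlg hM, q, fun x => ⟨?_, ?_⟩⟩
  · change (PRelSigma.flipAlg M).runAux O x (q.eval x.length) [] = _
    rw [PRelSigma.runAux_flipAlg, show M.runAux O x (q.eval x.length) [] = M.run O (q.eval x.length) x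
      from rfl, (hq x).1, Option.map_some]
    congr 1
    by_cases hx : x ∈ L
    · rw [(Set.mem_iff_boolIndicator _ _).1 hx, (Set.notMem_iff_boolIndicator _ _).1
        (show x ∉ Lᶜ from fun h => h hx)]
      rfl
    · rw [(Set.notMem_iff_boolIndicator _ _).1 hx, (Set.mem_iff_boolIndicator _ _).1
        (show x ∈ Lᶜ from hx)]
      rfl
  · intro y hy
    have e : (PRelSigma.flipAlg M).queries O (q.eval x.length) x = M.queries O (q.eval x.length) x :=
      PRelSigma.queriesAux_flipAlg M O x _ _
    rw [e] at hy
    exact (hq x).2 y hy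

/-- **`A ∈ Σₖᵖ ⇒ P^A ⊆ Σₖ₊₂ᵖ`** (module docstring: guess the answer string, verify with one
universal quantifier over rounds and refuting certificates; `Σₖ₊₂ = ∃ᵖ·Πₖ₊₁`, `Πₖ₊₁ = ∀ᵖ·Σₖ`).
(Stockmeyer 1976, §3 and proof of Thm. 3.1, in the weakened two-level form.) [cite: Stockmeyer1976, §3 (inclusion structure) with Thm. 3.1] -/
theorem PRel_ofLanguage_subset_SigmaP_add_two {k : ℕ} {A : Language Bool} (hA : A ∈ SigmaP k) :
    PRel (Oracle.ofLanguage A) ⊆ SigmaP (k + 2) := by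
  intro L hL
  obtain ⟨M, hM, q, hq⟩ := hL
  obtain ⟨B, hB, pA, hpA⟩ := exists_rep_of_mem_SigmaP hA
  refine ⟨PRelSigma.allLang M A B pA q (PRelSigma.zBound pA q), ?_, q, fun x =>
    PRelSigma.mem_iff_exists_allLang hpA hq x⟩
  exact PRelSigma.allLang_mem_polyForall M A B pA q
    (PRelSigma.matrixLang_mem_SigmaP M A B pA q hM hA hB) _

/-- **`A ∈ Σₖᵖ ⇒ P^A ⊆ Πₖ₊₂ᵖ`** (apply the `Σ` inclusion to the complement, `P^A` being closed
under complement). (Stockmeyer 1976, §3.) [cite: Stockmeyer1976, §3 (inclusion structure) with Thm. 3.1] -/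
theorem PRel_ofLanguage_subset_PiP_add_two {k : ℕ} {A : Language Bool} (hA : A ∈ SigmaP k) :
    PRel (Oracle.ofLanguage A) ⊆ PiP (k + 2) := fun _ hL =>
  PRel_ofLanguage_subset_SigmaP_add_two hA (compl_mem_PRel hL)

/-- **`Δₖ₊₁ᵖ ⊆ Σₖ₊₂ᵖ ∩ Πₖ₊₂ᵖ`** (`Δₖ₊₁ = P^{Σₖ}`). (Stockmeyer 1976, §3, inclusion diagram, weakened
by one level.) This does NOT discharge the one-level named fact
`Literature.Computability.QuantumComplexity.DeltaP_succ_subset_SigmaP_inter_PiP` (`Δₖ₊₁ ⊆ Σₖ₊₁ ∩ Πₖ₊₁`), which remains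
open in this file; use `DeltaP_subset_PH` when only `Δₖ ⊆ PH` is needed. [cite: Stockmeyer1976, §3 (inclusion structure) with Thm. 3.1] -/
theorem DeltaP_succ_subset_SigmaP_add_two (k : ℕ) :
    DeltaP (k + 1) ⊆ SigmaP (k + 2) ∩ PiP (k + 2) := by
  intro L hL
  obtain ⟨A, hA, hLA⟩ := mem_PRelClass_iff.1 hL
  exact ⟨PRel_ofLanguage_subset_SigmaP_add_two hA hLA, PRel_ofLanguage_subset_PiP_add_two hA hLA⟩

/-- **`Δₖᵖ ⊆ PH`** for every `k`. (Stockmeyer 1976, §3.) [cite: Stockmeyer1976, §3 (inclusion structure) with Thm. 3.1] -/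
theorem DeltaP_subset_PH (k : ℕ) : DeltaP k ⊆ PH := by
  cases k with
  | zero => exact SigmaP_subset_PH 0
  | succ k => exact fun L hL => SigmaP_subset_PH (k + 2) (DeltaP_succ_subset_SigmaP_add_two k hL).1

end Literature.Computability.Complexity
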